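import Literature.MeasureTheory.Integral.BathtubPrinciple
import Mathlib.MeasureTheory.Integral.IntervalIntegral.FundThmCalculus
import Mathlib.MeasureTheory.Measure.Lebesgue.Basic
import Mathlib.Analysis.SpecialFunctions.Log.Deriv
import Mathlib.Analysis.Real.Pi.Bounds
import Literature.NumberTheory.LFunctions.WeilArchimedeanMoments
import Literature.NumberTheory.LFunctions.RiemannSiegelStirling

/-!
# Stub `stub_archBathtub` of line `Sketch`, crux `WeilComb.CombShapePositivity`
(item stmt-RiemannHypothesis-11229, route route-RiemannHypothesis-WeilComb; siege attempt k5 —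
variation: the bathtub principle as a measure-theoretic rearrangement inequality)

For a Weil test `g` write `L = ‖g‖₁` (`weilNorm1`), `N = ‖g‖₂²` (`weilNorm2Sq`), and assume `0 < L`,
`2L² ≤ πN`. Then

`N (log(N/(2L²)) − 1) − (21/(5π)) L² ≤ Re W_∞(g ⋆ g̃)`.

## Proof

1. *The archimedean diagonal as a weighted Plancherel integral.*
   `Re W_∞(g ⋆ g̃) = (1/2π) ∫ G ρ − N log π`, `G(u) = |ĝ(1/2 + iu)|²`, `ρ(u) = Re ψ(1/4 + iu/2)`
   (`weilArchIntegral_weilConv_weilReflect`, `weilConv_weilReflect_apply_zero`).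
2. *Bathtub principle* — the measure-space rearrangement inequality of Lieb–Loss, *Analysis*,
   Thm. 1.14 (elementary "sublevel set" half), IMPORTED from the Literature tree
   (`Literature.MeasureTheory.Integral.bathtub_mul_setIntegral_le`, `BathtubPrinciple.lean`):
   if `0 ≤ f ≤ A`, `∫ f dμ = A μ(S)` and the weight `w` is `≤ s` on `S` and `≥ s` off `S`, then
   `A ∫_S w ≤ ∫ f w` — pouring the mass of `f` into the tub `S` can only lower the weighted
   integral, because `(f − A·1_S)(w − s) ≥ 0` pointwise.  Here `μ` is Lebesgue measure on `ℝ`,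
   `f = G ≤ L² = A` (`norm_weilMellin_half_line_le`),
   `∫ G = 2πN` (Plancherel, `integral_norm_sq_weilMellin_half_line`), `w = ρ` is even and increasing
   in `|u|` (`reDigammaQuarter_mono`), `S = (−T, T]` with `T = πN/L²` (so `L² · 2T = 2πN`) and
   `s = ρ(T)`; hence `L² ∫_{−T}^{T} ρ ≤ ∫ G ρ`.
3. *The digamma integral.* For `T ≥ 2`, `∫_{−T}^{T} ρ ≥ 2T(log(T/2) − 1) − 42/5`: by evenness it is
   `2 ∫₀^T ρ`; on `[0,½] ∪ [½,1] ∪ [1,2]` use the monotone step minorant `ρ ≥ ρ(0), ρ(½), ρ(1)` with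
   `ρ(½) ≥ ψ(¼) + 2`, `ρ(1) ≥ ψ(¼) + 16/5` (first term of the vertical series, `sum_digammaTerm_le`)
   and `ψ(¼) ≥ −4.22745354`; on `[2, T]` use the first-order Stirling bound with rate,
   `ρ(u) ≥ log(u/2) − 4K/u²`, `K = stirlingVertRate ¼ ≤ 21/32`
   (`abs_re_digamma_vertical_sub_log_le`), integrated through the FTC inequality
   `intervalIntegral.sub_le_integral_of_hasDeriv_right_of_le` with the primitive
   `u log(u/2) − u + 4K/u`.
4. *Assembly*: `(1/2π) L² (2T(log(T/2) − 1) − 42/5) − N log π = N (log(N/(2L²)) − 1) − (21/(5π)) L²`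
   since `L² T = πN`.

The signature of `stub_archBathtub` is the registered one (skeleton `Lines/Sketch.lean`,
sha `86d35e56a923`).
-/

noncomputable section

-- the sub-problem path `RiemannHypothesis/RiemannHypothesis` duplicates a namespace (D-0017)
set_option linter.dupNamespace false

open MeasureTheory Set Complex

namespace Summit.RiemannHypothesis.RiemannHypothesis.Theorems.WeilCombBohrFejerBathtubK5

open Literature.NumberTheory.LFunctions
open Literature.Analysis.SpecialFunctions (reDigammaQuarter reDigammaQuarter_zero
  reDigammaQuarter_even reDigammaQuarter_mono reDigammaQuarter_zero_le continuous_reDigammaQuarter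
  sum_digammaTerm_le digammaTerm digammaNode re_digamma_one_quarter_ge)

/-! ### 1. The digamma integral `∫_{-T}^{T} Re ψ(1/4 + iu/2) du` -/

/-- First-order Stirling minorant with rate on `[2, ∞)`: `log u − log 2 − 4K/u² ≤ Re ψ(1/4 + iu/2)`,
`K = stirlingVertRate ¼` (`abs_re_digamma_vertical_sub_log_le` at `σ = ¼`, height `u/2 ≥ 1`).
[folklore] -/
theorem reDigammaQuarter_ge_log_sub {u : ℝ} (hu : 2 ≤ u) :
    Real.log u - Real.log 2 - 4 * stirlingVertRate (1 / 4) / u ^ 2 ≤ reDigammaQuarter u := by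
  have h := abs_re_digamma_vertical_sub_log_le (σ := 1 / 4) (u := u / 2) (by norm_num)
    (by linarith)
  have e : ((1 / 4 : ℝ) : ℂ) + ((u / 2 : ℝ) : ℂ) * I = 1 / 4 + (u : ℂ) / 2 * I := by
    push_cast
    ring
  rw [e] at h
  have h' := (abs_le.1 h).1
  have hlog : Real.log (u / 2) = Real.log u - Real.log 2 :=
    Real.log_div (by linarith) (by norm_num)
  have hsq : stirlingVertRate (1 / 4) / (u / 2) ^ 2 = 4 * stirlingVertRate (1 / 4) / u ^ 2 := by
    have hu0 : u ≠ 0 := by linarith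
    field_simp
    ring
  rw [hlog, hsq] at h'
  unfold reDigammaQuarter
  linarith

/-- The tail piece: for `T ≥ 2`,
`T(log T − log 2) − T + 2 − 2K ≤ ∫₂^T Re ψ(1/4 + iu/2) du`, by the FTC inequality for the primitive
`u (log u − log 2) − u + 4K/u` of the minorant `log u − log 2 − 4K/u²`. [folklore] -/
theorem integral_two_le_ge {T : ℝ} (hT : 2 ≤ T) :
    T * (Real.log T - Real.log 2) - T + 2 - 2 * stirlingVertRate (1 / 4) ≤
      ∫ u in (2 : ℝ)..T, reDigammaQuarter u := by
  set K : ℝ := stirlingVertRate (1 / 4) with hK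
  have hK0 : 0 ≤ K := by
    rw [hK, stirlingVertRate]
    positivity
  set F : ℝ → ℝ := fun u ↦ u * (Real.log u - Real.log 2) - u + 4 * K * u⁻¹ with hF
  have hd : ∀ u : ℝ, 0 < u → HasDerivAt F (Real.log u - Real.log 2 - 4 * K / u ^ 2) u := by
    intro u hu
    have h1 : HasDerivAt (fun u : ℝ ↦ u * (Real.log u - Real.log 2))
        (1 * (Real.log u - Real.log 2) + u * u⁻¹) u :=
      (hasDerivAt_id' u).mul ((Real.hasDerivAt_log hu.ne').sub_const (Real.log 2))
    have h2 : HasDerivAt (fun u : ℝ ↦ 4 * K * u⁻¹) (4 * K * (-(u ^ 2)⁻¹)) u :=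
      (hasDerivAt_inv hu.ne').const_mul (4 * K)
    refine ((h1.sub (hasDerivAt_id' u)).add h2).congr_deriv ?_
    field_simp
    ring
  have hFTC := intervalIntegral.sub_le_integral_of_hasDeriv_right_of_le hT
    (fun u hu ↦ (hd u (by linarith [hu.1])).continuousAt.continuousWithinAt)
    (fun u hu ↦ (hd u (by linarith [hu.1])).hasDerivWithinAt)
    (continuous_reDigammaQuarter.integrableOn_Icc)
    (fun u hu ↦ reDigammaQuarter_ge_log_sub hu.1.le)
  have hF2 : F 2 = -2 + 2 * K := by
    simp only [hF, sub_self, mul_zero, zero_sub]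
    ring
  have hFT : T * (Real.log T - Real.log 2) - T ≤ F T := by
    have hT0 : 0 < T := by linarith
    have : 0 ≤ 4 * K * T⁻¹ := by positivity
    simp only [hF]
    linarith
  linarith

/-- The central piece: `2 ψ(¼) + 21/5 ≤ ∫₀² Re ψ(1/4 + iu/2) du`, from the monotone step minorant
on `[0, ½] ∪ [½, 1] ∪ [1, 2]` with `ρ(½) ≥ ψ(¼) + 2`, `ρ(1) ≥ ψ(¼) + 16/5` (first term
`16t²/(1 + 4t²)` of the vertical series). [folklore] -/
theorem integral_zero_two_ge :
    2 * reDigammaQuarter 0 + 21 / 5 ≤ ∫ u in (0 : ℝ)..2, reDigammaQuarter u := by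
  have hc := continuous_reDigammaQuarter
  have hhalf : reDigammaQuarter 0 + 2 ≤ reDigammaQuarter (1 / 2) := by
    have h := sum_digammaTerm_le 1 (1 / 2)
    rw [Finset.sum_range_one] at h
    have e : digammaTerm (digammaNode 0) (1 / 2) = 2 := by
      unfold digammaTerm digammaNode
      norm_num
    linarith
  have hone : reDigammaQuarter 0 + 16 / 5 ≤ reDigammaQuarter 1 := by
    have h := sum_digammaTerm_le 1 1
    rw [Finset.sum_range_one] at h
    have e : digammaTerm (digammaNode 0) 1 = 16 / 5 := by
      unfold digammaTerm digammaNode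
      norm_num
    linarith
  have h1 : (1 / 2 - 0) * reDigammaQuarter 0 ≤ ∫ u in (0 : ℝ)..(1 / 2), reDigammaQuarter u := by
    have h := intervalIntegral.integral_mono_on (μ := volume) (a := (0 : ℝ)) (b := 1 / 2)
      (f := fun _ ↦ reDigammaQuarter 0) (g := reDigammaQuarter) (by norm_num)
      (continuous_const.intervalIntegrable _ _) (hc.intervalIntegrable _ _)
      (fun u _ ↦ reDigammaQuarter_zero_le u)
    rwa [intervalIntegral.integral_const, smul_eq_mul] at h
  have h2 : (1 - 1 / 2) * (reDigammaQuarter 0 + 2) ≤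
      ∫ u in (1 / 2 : ℝ)..1, reDigammaQuarter u := by
    have h := intervalIntegral.integral_mono_on (μ := volume) (a := (1 / 2 : ℝ)) (b := 1)
      (f := fun _ ↦ reDigammaQuarter 0 + 2) (g := reDigammaQuarter) (by norm_num)
      (continuous_const.intervalIntegrable _ _) (hc.intervalIntegrable _ _)
      (fun u hu ↦ hhalf.trans (reDigammaQuarter_mono (by
        rw [abs_of_nonneg (by norm_num : (0 : ℝ) ≤ 1 / 2), abs_of_nonneg (by linarith [hu.1])]
        exact hu.1)))
    rwa [intervalIntegral.integral_const, smul_eq_mul] at h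
  have h3 : (2 - 1) * (reDigammaQuarter 0 + 16 / 5) ≤ ∫ u in (1 : ℝ)..2, reDigammaQuarter u := by
    have h := intervalIntegral.integral_mono_on (μ := volume) (a := (1 : ℝ)) (b := 2)
      (f := fun _ ↦ reDigammaQuarter 0 + 16 / 5) (g := reDigammaQuarter) (by norm_num)
      (continuous_const.intervalIntegrable _ _) (hc.intervalIntegrable _ _)
      (fun u hu ↦ hone.trans (reDigammaQuarter_mono (by
        rw [abs_of_nonneg (by norm_num : (0 : ℝ) ≤ 1), abs_of_nonneg (by linarith [hu.1])]
        exact hu.1)))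
    rwa [intervalIntegral.integral_const, smul_eq_mul] at h
  have hadd1 := intervalIntegral.integral_add_adjacent_intervals
    (hc.intervalIntegrable (μ := volume) 0 (1 / 2)) (hc.intervalIntegrable (μ := volume) (1 / 2) 1)
  have hadd2 := intervalIntegral.integral_add_adjacent_intervals
    (hc.intervalIntegrable (μ := volume) 0 1) (hc.intervalIntegrable (μ := volume) 1 2)
  linarith

/-- **The digamma integral.** For `T ≥ 2`:
`2T(log T − log 2 − 1) − 42/5 ≤ ∫_{−T}^{T} Re ψ(1/4 + iu/2) du` (evenness, the two pieces above,
`ψ(¼) ≥ −4.22745354` and `K = 1/6 + π/12 + 1/32 + 1/8 ≤ 21/32`). [folklore] -/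
theorem integral_reDigammaQuarter_symm_ge {T : ℝ} (hT : 2 ≤ T) :
    2 * T * (Real.log T - Real.log 2 - 1) - 42 / 5 ≤ ∫ u in (-T)..T, reDigammaQuarter u := by
  have hc := continuous_reDigammaQuarter
  have h02 := integral_zero_two_ge
  have h2T := integral_two_le_ge hT
  have hρ0 : (-4.22745354 : ℝ) ≤ reDigammaQuarter 0 := by
    rw [reDigammaQuarter_zero]
    exact re_digamma_one_quarter_ge
  have hK : stirlingVertRate (1 / 4) ≤ 21 / 32 := by
    rw [stirlingVertRate]
    have := Real.pi_le_four
    nlinarith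
  have h0T : ∫ u in (0 : ℝ)..T, reDigammaQuarter u =
      (∫ u in (0 : ℝ)..2, reDigammaQuarter u) + ∫ u in (2 : ℝ)..T, reDigammaQuarter u :=
    (intervalIntegral.integral_add_adjacent_intervals (hc.intervalIntegrable _ _)
      (hc.intervalIntegrable _ _)).symm
  have hneg : ∫ u in (-T)..0, reDigammaQuarter u = ∫ u in (0 : ℝ)..T, reDigammaQuarter u := by
    have h := intervalIntegral.integral_comp_neg (f := reDigammaQuarter) (a := 0) (b := T)
    simp only [reDigammaQuarter_even, neg_zero] at h
    exact h.symm
  have hsplit : ∫ u in (-T)..T, reDigammaQuarter u =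
      (∫ u in (-T)..0, reDigammaQuarter u) + ∫ u in (0 : ℝ)..T, reDigammaQuarter u :=
    (intervalIntegral.integral_add_adjacent_intervals (hc.intervalIntegrable _ _)
      (hc.intervalIntegrable _ _)).symm
  rw [hsplit, hneg, h0T]
  linarith

/-! ### 2. The stub (bathtub principle from `Literature.MeasureTheory.Integral`) -/

/-- **Stub S3 (`stub_archBathtub`) — bathtub bound for the archimedean diagonal of a Weil test.**
For a Weil test `g` with `0 < ‖g‖₁` and `2‖g‖₁² ≤ π‖g‖₂²`:
`‖g‖₂² (log(‖g‖₂²/(2‖g‖₁²)) − 1) − (21/(5π)) ‖g‖₁² ≤ Re W_∞(g ⋆ g̃)`.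
Signature verbatim from the registered skeleton of line `Sketch` (crux
`WeilComb.CombShapePositivity`, stmt-RiemannHypothesis-11229). Proof: weighted Plancherel form of
`Re W_∞(g ⋆ g̃)`, the measure-theoretic bathtub principle
`Literature.MeasureTheory.Integral.bathtub_mul_setIntegral_le`
(Lieb–Loss, Thm. 1.14) on `(ℝ, Lebesgue)` with tub `(−T, T]`, `T = π‖g‖₂²/‖g‖₁²`, level `ρ(T)`,
and the digamma integral bound `integral_reDigammaQuarter_symm_ge`. [folklore] -/
theorem stub_archBathtub : ∀ g : ℝ → ℂ, IsWeilTest g → 0 < weilNorm1 g →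
    2 * weilNorm1 g ^ 2 ≤ Real.pi * weilNorm2Sq g →
    weilNorm2Sq g * (Real.log (weilNorm2Sq g / (2 * weilNorm1 g ^ 2)) - 1) -
        21 / (5 * Real.pi) * weilNorm1 g ^ 2 ≤
      (weilArchTerm (weilConv g (weilReflect g))).re := by
  intro g hg hL hcond
  set L : ℝ := weilNorm1 g with hLdef
  set N : ℝ := weilNorm2Sq g with hNdef
  have hπ : 0 < Real.pi := Real.pi_pos
  have hL2 : 0 < L ^ 2 := by positivity
  have hN : 0 < N := by
    by_contra h
    push Not at h
    nlinarith
  set T : ℝ := Real.pi * N / L ^ 2 with hTdef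
  have hLT : L ^ 2 * T = Real.pi * N := by
    rw [hTdef]
    field_simp
  have hT2 : 2 ≤ T := by
    rw [hTdef, le_div_iff₀ hL2]
    linarith
  have hT0 : 0 ≤ T := by linarith
  -- Step 1: the archimedean term as a weighted Plancherel integral
  set X : ℝ := ∫ t : ℝ, ‖weilMellin g (1 / 2 + t * I)‖ ^ 2 * reDigammaQuarter t with hXdef
  have hW : (weilArchTerm (weilConv g (weilReflect g))).re =
      1 / (2 * Real.pi) * X - N * Real.log Real.pi := by
    unfold weilArchTerm
    rw [weilArchIntegral_weilConv_weilReflect hg, weilConv_weilReflect_apply_zero]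
    have e : ((1 / (2 * Real.pi) : ℂ) * ((∫ t : ℝ, ‖weilMellin g (1 / 2 + t * I)‖ ^ 2 *
          (Complex.digamma (1 / 4 + t / 2 * I)).re : ℝ) : ℂ) -
          ((∫ t : ℝ, ‖g t‖ ^ 2 : ℝ) : ℂ) * (Real.log Real.pi : ℂ)) =
        ((1 / (2 * Real.pi) * (∫ t : ℝ, ‖weilMellin g (1 / 2 + t * I)‖ ^ 2 *
          (Complex.digamma (1 / 4 + t / 2 * I)).re) -
            weilNorm2Sq g * Real.log Real.pi : ℝ) : ℂ) := by
      unfold weilNorm2Sq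
      push_cast
      ring
    rw [e, Complex.ofReal_re]
    rfl
  -- Step 2: the bathtub principle with tub `(−T, T]`
  have hbath : L ^ 2 * ∫ u in Ioc (-T) T, reDigammaQuarter u ≤ X := by
    refine Literature.MeasureTheory.Integral.bathtub_mul_setIntegral_le (μ := volume)
      (s := reDigammaQuarter T) measurableSet_Ioc measure_Ioc_lt_top.ne (fun t ↦ by positivity)
      (fun t ↦ pow_le_pow_left₀ (norm_nonneg _) (norm_weilMellin_half_line_le hg t) 2)
      (fun u hu ↦ reDigammaQuarter_mono ?_) (fun u hu ↦ reDigammaQuarter_mono ?_)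
      (integrable_norm_sq_weilMellin_half_line hg)
      (integrable_norm_sq_weilMellin_mul_reDigammaQuarter hg)
      (continuous_reDigammaQuarter.integrableOn_Ioc) ?_
    · rw [abs_of_nonneg hT0]
      exact abs_le.2 ⟨hu.1.le, hu.2⟩
    · rw [abs_of_nonneg hT0]
      rw [mem_Ioc, not_and_or, not_lt, not_le] at hu
      rcases hu with hu | hu
      · linarith [neg_le_abs u]
      · linarith [le_abs_self u]
    · rw [integral_norm_sq_weilMellin_half_line hg, Real.volume_real_Ioc_of_le (by linarith),
        ← hNdef]
      linear_combination (-2 : ℝ) * hLT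
  -- Step 3: the digamma integral
  have hJ := integral_reDigammaQuarter_symm_ge hT2
  rw [intervalIntegral.integral_of_le (by linarith : -T ≤ T)] at hJ
  -- Step 4: assembly
  have hlogT : Real.log T = Real.log Real.pi + Real.log N - Real.log (L ^ 2) := by
    rw [hTdef, Real.log_div (by positivity) hL2.ne', Real.log_mul hπ.ne' hN.ne']
  have hlogQ : Real.log (N / (2 * L ^ 2)) = Real.log N - Real.log 2 - Real.log (L ^ 2) := by
    rw [Real.log_div hN.ne' (by positivity), Real.log_mul (by norm_num) hL2.ne']
    ring
  have hmain : L ^ 2 * (2 * T * (Real.log T - Real.log 2 - 1) - 42 / 5) ≤ X :=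
    (mul_le_mul_of_nonneg_left hJ hL2.le).trans hbath
  have hkey : 2 * Real.pi * (N * (Real.log (N / (2 * L ^ 2)) - 1) - 21 / (5 * Real.pi) * L ^ 2)
      ≤ 2 * Real.pi * (1 / (2 * Real.pi) * X - N * Real.log Real.pi) := by
    have e1 : 2 * Real.pi * (N * (Real.log (N / (2 * L ^ 2)) - 1) - 21 / (5 * Real.pi) * L ^ 2) =
        2 * (Real.pi * N) * (Real.log (N / (2 * L ^ 2)) - 1) - 42 / 5 * L ^ 2 := by
      field_simp
      ring
    have e2 : 2 * Real.pi * (1 / (2 * Real.pi) * X - N * Real.log Real.pi) =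
        X - 2 * (Real.pi * N) * Real.log Real.pi := by
      field_simp
    rw [e1, e2, ← hLT, hlogQ]
    rw [hlogT] at hmain
    nlinarith [hmain, hL2]
  rw [hW]
  exact le_of_mul_le_mul_left hkey (by positivity)

end Summit.RiemannHypothesis.RiemannHypothesis.Theorems.WeilCombBohrFejerBathtubK5

end
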